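import Summits.CriticalPhenomena.PercolationContinuityZ3.Theorems.SoloInformedSlabCriticalDensity
import HarnessLib

/-!
# `θ(p_c) = 0` as a limit of certifiable statements: the `ε`-certificate form

`θ(p_c(ℤ^d)) = 0` is not witnessed by any single finite-volume event at `p_c` (the set
`{p : θ(p) = 0}` is not open to the right of `p_c`), but each of its instances `θ(p_c) < ε` IS
witnessed by a SUPERCRITICAL finite-volume computation, and the conjunct is exactly the conjunction
of these instances:

* `percolationContinuity_iff_forall_exists_supercritical_oneArm` (`d ≥ 2`) —
  **`θ(p_c) = 0 ↔ ∀ ε > 0, ∃ p, ∃ K, θ(p) > 0 ∧ P_p(0 ↔ ∂Λ_K) < ε`.**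
  (←): `θ(p) > 0` puts `p ≥ p_c`, so `θ(p_c) ≤ θ(p) ≤ P_p(0 ↔ ∂Λ_K) < ε`. (→): a scale `K` with
  `P_{p_c}(0 ↔ ∂Λ_K) < ε/2`, continuity of the local event in `p`, and `θ > 0` on `(p_c, 1]`
  (`p_c < 1`).
* `percolationContinuityZ3_iff_forall_exists_slabSupercritical_oneArm` (`ℤ³`) — the percolation
  witness may be taken to be a SLAB: **`θ(p_c(ℤ³)) = 0 ↔ ∀ ε > 0, ∃ p k K, θ_{C_k}(p) > 0 ∧
  P_p(0 ↔ ∂Λ_K) < ε`** (`C_k = {-k ≤ x₀ ≤ k}`; (→) uses Grimmett–Marstrand `p_c(C_k) ↓ p_c`, a theorem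
  of the tree). A triple `(p, k, K)` with `θ_{C_k}(p) > 0` and `P_p(0 ↔ ∂Λ_K) < ε` is a CERTIFICATE of
  `θ(p_c(ℤ³)) < ε` (`theta_criticalProbI_lt_of_certificate`); in the jump world no certificate exists
  below `ε = θ(p_c)`, in the continuity world certificates exist for every `ε`.

So the necessary property "N3" of the census (no finite-size criterion decides `θ(p_c) = 0`) is
sharp in the following sense: every strict upper bound on `θ(p_c)` is finitely certifiable from
above `p_c`, and only the passage `ε → 0` is not. Solo seat `solo-CriticalPhenomena-informed`,
`paper/sharpest-statement.md` §7 (form #13).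

References: G. Grimmett, *Percolation* (1999), §1.4 (`θ(p) ≤ P_p(0 ↔ ∂B(n))`, Thm. (1.10)
`p_c < 1`), Thm. (7.2) p. 148 (Grimmett–Marstrand), §8.3 (right continuity of `θ`).
-/

noncomputable section

namespace Summit.CriticalPhenomena.PercolationContinuityZ3.Theorems

open MeasureTheory Filter Topology
open Literature.Probability.Percolation Literature.Probability.LatticeModels
open Literature.Barriers.CriticalPhenomena

/-- **A certificate of `θ(p_c) < ε`** (any graph `ℤ^d`): a parameter `p` at which the origin
percolates with positive probability and a scale `K` with `P_p(0 ↔ ∂Λ_K) < ε`. -/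
theorem theta_criticalProbI_lt_of_supercritical_oneArm {d : ℕ} {p : unitInterval} {K : ℕ} {ε : ℝ}
    (hθ : 0 < theta (zdGraph d) 0 p)
    (hK : (bondPercolation (zdGraph d) p).real (siteToBoundary d K) < ε) :
    theta (zdGraph d) 0 (criticalProbI d) < ε := by
  have hle : criticalProbI d ≤ p := criticalProb_le_of_theta_pos (zdGraph d) 0 p hθ
  exact ((theta_mono_holds (zdGraph d) 0 hle).trans (DCT16.theta_le_real_siteToBoundary p K)).trans_lt hK

/-- **`θ(p_c(ℤ^d)) = 0 ↔ ∀ ε > 0, ∃ p K, θ(p) > 0 ∧ P_p(0 ↔ ∂Λ_K) < ε`** (`d ≥ 2`): the conjunct is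
the conjunction over `ε` of statements each of which is witnessed by a supercritical parameter and
a finite-volume one-arm probability. -/
theorem percolationContinuity_iff_forall_exists_supercritical_oneArm {d : ℕ} (hd : 2 ≤ d) :
    PercolationContinuity d ↔
      ∀ ε : ℝ, 0 < ε → ∃ p : unitInterval, ∃ K : ℕ,
        0 < theta (zdGraph d) 0 p ∧ (bondPercolation (zdGraph d) p).real (siteToBoundary d K) < ε := by
  constructor
  · intro h ε hε
    have h0 : theta (zdGraph d) 0 (criticalProbI d) = 0 := h
    obtain ⟨K, hK⟩ : ∃ K,
        (bondPercolation (zdGraph d) (criticalProbI d)).real (siteToBoundary d K) < ε / 2 := by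
      by_contra hcon
      push Not at hcon
      have := DCT16.le_theta_of_forall_le_real_siteToBoundary (criticalProbI d) hcon
      linarith
    have hcont := continuous_bondPercolation_real_of_determinedBy (zdGraph d)
      (DCT16.determinedBy_siteToBoundary d K)
    obtain ⟨δ, hδ, hδε⟩ := Metric.continuous_iff.1 hcont (criticalProbI d) (ε / 2) (by linarith)
    have hpc1 : criticalProb (zdGraph d) (0 : Site d) < 1 := criticalProb_zd_lt_one hd
    have hpc0 : 0 ≤ criticalProb (zdGraph d) (0 : Site d) := (criticalProb_mem_Icc _ _).1
    set t : ℝ := min (criticalProb (zdGraph d) (0 : Site d) + δ / 2) 1 with ht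
    have ht0 : 0 ≤ t := le_min (by linarith) zero_le_one
    have ht1 : t ≤ 1 := min_le_right _ _
    have htI : t ∈ Set.Icc (0 : ℝ) 1 := ⟨ht0, ht1⟩
    obtain ⟨p, hp⟩ : ∃ p : unitInterval, (p : ℝ) = t := ⟨⟨t, htI⟩, rfl⟩
    have hlt : criticalProb (zdGraph d) (0 : Site d) < (p : ℝ) := by
      rw [hp]; exact lt_min (by linarith) hpc1
    have hle' : (p : ℝ) ≤ criticalProb (zdGraph d) (0 : Site d) + δ / 2 := by
      rw [hp]; exact min_le_left _ _
    have hdist : dist p (criticalProbI d) < δ := by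
      rw [Subtype.dist_eq, Real.dist_eq, coe_criticalProbI, abs_of_pos (sub_pos.2 hlt)]
      linarith
    refine ⟨p, K, theta_pos_of_criticalProb_lt_holds (zdGraph d) 0 p hlt, ?_⟩
    have h1 := hδε p hdist
    rw [Real.dist_eq] at h1
    have h2 := (abs_sub_lt_iff.1 h1).1
    linarith
  · intro h
    have key : ∀ ε : ℝ, 0 < ε → theta (zdGraph d) 0 (criticalProbI d) ≤ ε := fun ε hε => by
      obtain ⟨p, K, hθ, hK⟩ := h ε hε
      exact (theta_criticalProbI_lt_of_supercritical_oneArm hθ hK).le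
    exact le_antisymm (le_of_forall_pos_le_add fun ε hε => by simpa using key ε hε)
      measureReal_nonneg

/-- The `ℤ³` case. -/
theorem percolationContinuityZ3_iff_forall_exists_supercritical_oneArm :
    PercolationContinuityZ3 ↔
      ∀ ε : ℝ, 0 < ε → ∃ p : unitInterval, ∃ K : ℕ,
        0 < theta (zdGraph 3) (0 : Site 3) p ∧
          (bondPercolation (zdGraph 3) p).real (siteToBoundary 3 K) < ε :=
  percolationContinuity_iff_forall_exists_supercritical_oneArm (by norm_num)

/-- **A slab certificate of `θ(p_c(ℤ³)) < ε`**: `θ_{C_k}(p) > 0` (the centred slab of half-width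
`k` percolates at `p`) and `P_p(0 ↔ ∂Λ_K) < ε`. -/
theorem theta_criticalProbI_lt_of_certificate {p : unitInterval} {k K : ℕ} {ε : ℝ}
    (hθ : 0 < theta (cslabGraph k) (cslabOrigin k) p)
    (hK : (bondPercolation (zdGraph 3) p).real (siteToBoundary 3 K) < ε) :
    theta (zdGraph 3) (0 : Site 3) (criticalProbI 3) < ε :=
  theta_criticalProbI_lt_of_supercritical_oneArm (hθ.trans_le (theta_cslab_le k p)) hK

/-- **`θ(p_c(ℤ³)) = 0 ↔ ∀ ε > 0, ∃ p k K, θ_{C_k}(p) > 0 ∧ P_p(0 ↔ ∂Λ_K) < ε`**: the conjunct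
is the conjunction of its slab-certifiable instances. (→): a supercritical `p` close to `p_c` with
small one-arm probability (previous theorem) lies above `p_c(C_k)` for some `k` by
Grimmett–Marstrand (`criticalProb_cslab_le_of_sprinkling`, a theorem of the tree), so `C_k`
percolates at `p`; (←): `theta_criticalProbI_lt_of_certificate`. -/
theorem percolationContinuityZ3_iff_forall_exists_slabSupercritical_oneArm :
    PercolationContinuityZ3 ↔
      ∀ ε : ℝ, 0 < ε → ∃ p : unitInterval, ∃ k K : ℕ,
        0 < theta (cslabGraph k) (cslabOrigin k) p ∧
          (bondPercolation (zdGraph 3) p).real (siteToBoundary 3 K) < ε := by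
  constructor
  · intro h ε hε
    obtain ⟨p, K, hθ, hK⟩ :=
      percolationContinuityZ3_iff_forall_exists_supercritical_oneArm.1 h ε hε
    -- `θ(p) > 0` at `p = p_c` is excluded by `h`, so `p > p_c`, and some slab is critical below `p`
    have hne : p ≠ criticalProbI 3 := by
      rintro rfl
      have h0 : theta (zdGraph 3) (0 : Site 3) (criticalProbI 3) = 0 := h
      exact hθ.ne' h0
    have hge : criticalProbI 3 ≤ p := criticalProb_le_of_theta_pos (zdGraph 3) 0 p hθ
    have hgt : (criticalProbI 3 : ℝ) < p := lt_of_le_of_ne hge (fun heq => hne (Subtype.ext heq).symm)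
    have hη : 0 < ((p : ℝ) - criticalProb (zdGraph 3) (0 : Site 3)) / 2 := by
      rw [coe_criticalProbI] at hgt; linarith
    obtain ⟨k, hk⟩ := criticalProb_cslab_le_of_sprinkling SprinklingRenormalisation_holds hη
    have hlt : criticalProb (cslabGraph k) (cslabOrigin k) < p := by
      rw [coe_criticalProbI] at hgt; linarith
    exact ⟨p, k, K, theta_pos_of_criticalProb_lt_holds (cslabGraph k) (cslabOrigin k) p hlt, hK⟩
  · intro h
    have key : ∀ ε : ℝ, 0 < ε → theta (zdGraph 3) (0 : Site 3) (criticalProbI 3) ≤ ε := fun ε hε => by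
      obtain ⟨p, k, K, hθ, hK⟩ := h ε hε
      exact (theta_criticalProbI_lt_of_certificate hθ hK).le
    exact le_antisymm (le_of_forall_pos_le_add fun ε hε => by simpa using key ε hε)
      measureReal_nonneg

end Summit.CriticalPhenomena.PercolationContinuityZ3.Theorems

end
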